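import Literature.NumberTheory.Automorphic.Liu2021.LemD1Item1AtVOfFacts
import HarnessLib

/-!
# `hD1''` line `a4-liuD1pp`, stub (6) `stub_lemD1_item1_at_v : LemD1Item1AtV` — fan B's COMPOSITION, CLOSED IN THE TREE, BY NAME
# (cell `hodgecm-mathlib`, fan A ↔ fan B junction for the binder `HypD1pp` = stmt-HodgeConjecture-24838)

Summits side, binder subdirectory `CorCM/HypD1pp/`.  The crux skeleton `A-plan/lines/a4-liuD1pp.lean` (sha16 2ff805ec0320d57a,
REF1 PASS 2026-08-28T01:22:16Z, namespace `Summit.HodgeConjecture.CorCM.Lines.A4LiuD1pp`) registers as stub (6) fan B's kernel-checked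
COMPOSITION of line `b4-lemD1-item1-at-v` RESTATED AS A CLOSED STATEMENT, the Prop `PerPlace.LemD1Item1AtV`: for every quadratic `E/F`,
frame, line `a`, family `𝓢`, `n ≥ 3`, characters `μ, χ₁` and finite place `v` — the three MVW rank-one theta facts
(`mvw_IV4_rankOne_irreducibleOrZero`, `mvw_IV4_rankOne_admissible`, `mvw_IV2_rankOne_nonvanishing_of_isotropic`), unitarity of `ω_v` at `v`,
the split-place consequences and isotropy of `(E_vⁿ, J_V ⊗ (a))` IMPLY [Liu2021, Lem. D.1, first sentence + (1)] AS PRINTED at `v`: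
`LemD1_1AsPrinted (localLemD1Data … v)`.  («Registered only to decouple seating from the import question» — A-plan2.)

This file PROVES that statement, VERBATIM (the `∀`-closed body of `PerPlace.LemD1Item1AtV`, binders in B's `variable` order, then B's
theorem binders), by the tree theorem `Literature.NumberTheory.Automorphic.Liu2021.Def411WeilCarriers.lemD1_1AsPrinted_localLemD1Data_of`
(`Liu2021/LemD1Item1AtVOfFacts.lean`: fan B's composition — the MVW facts instantiated at the smooth section `𝓢.s v`, the split case under
unitarity, and the junction (T) → (D) `LemD1OfPlace.lemD1_1AsPrinted_data_of_theta`, the converse of the tree's `LemD1OfPlace.isIrreducible_rep_of_…`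
∕ `isAdmissible_rep_of_…` ∕ `nontrivial_coinv_of_lemD1_1AsPrinted`).  So at crux-write time the A-side stub closes by
`:= Summit.HodgeConjecture.CorCM.HypD1pp.lemD1Item1AtV` after `import Summits.HodgeConjecture.CorCM.HypD1pp.A4LiuD1ppLemD1Item1AtV`.

With `A4LiuD1ppIsotropyRankThree` (stub (5)) and `A4LiuD1ppSplitPlaceModelConsequencesOfFacts` (stub (4) from IV-3(a)(b)), the head
`HypD1pp_of` of `a4-liuD1pp` is reduced BY NAME to the four interface facts IV-1a `mvw_IV4_rankOne_irreducibleOrZero`, IV-3(a)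
`splitPlace_chiCoinv_iso_parabolicIndGL`, IV-3(b) `parabolicIndGL_detChar_unitary_isIrreducible` (open) and IV-1b ∕ IV-2 (PROVED:
`mvw_IV4_rankOne_admissible_holds` p595885, `mvw_IV2_rankOne_nonvanishing_of_isotropic_holds` p593652).
HC_CM is proved only modulo the 7 printed citations (`hDel`, `h21`, `hLiu418`, `h411`, `h413`, `hD3`, `hD1''`) until rung 0 closes; this file
discharges no binder and no interface fact.

## References
* [Liu2021] Y. Liu, Camb. J. Math. 9 (2021) = arXiv:2102.11518, App. D Lemma D.1, first sentence + (1) (l. 5226–5229), proof l. 5249–5266.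
* [MoeglinVignerasWaldspurger1987] C. Mœglin, M.-F. Vignéras, J.-L. Waldspurger, LNM 1291, Chap. 3 IV.2, IV.4 Thm principal 1a), 2a).
* [GelbartRogawski1990] S. Gelbart, J. Rogawski, §2.6.  [Zelevinsky1980] A. Zelevinsky, Ann. Sci. ÉNS 13, Thm 4.2.
-/

set_option autoImplicit false

noncomputable section

namespace Summit.HodgeConjecture.CorCM.HypD1pp

open scoped Matrix Kronecker TensorProduct Classical RestrictedProduct
open NumberField NumberField.mixedEmbedding IsDedekindDomain Filter Set
open Literature.NumberTheory.Automorphic Literature.NumberTheory.Automorphic.UnitaryGroup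
open Literature.NumberTheory.Weil1964 Literature.RepresentationTheory
open Literature.RepresentationTheory.HeisenbergGroup
open Literature.GroupTheory.RestrictedProductCharacter
open Literature.NumberTheory Literature.NumberTheory.GelbartRogawski1991 Literature.NumberTheory.GelbartRogawski1991.UnitaryDualPair
open Literature.NumberTheory.GelbartRogawski1991.UnitaryDualPair.WeilCoinv
open Literature.NumberTheory.Automorphic.Liu2021 Literature.NumberTheory.Automorphic.Liu2021.Def411WeilCarriers
open Literature.RepresentationTheory.CentralCharacterQuotient (augmentation quotRep)
open Literature.RepresentationTheory.MoeglinVignerasWaldspurger1987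
open MeasureTheory

/-- **Line `a4-liuD1pp`, stub (6) `LemD1Item1AtV`, PROVED** — [Liu2021, Lem. D.1, first sentence + (1)] AS PRINTED at a finite place `v`,
`n ≥ 3`, for the as-printed local datum `localLemD1Data … v` of any quadratic `E/F`, frame `J_V = T_V ⊗ 1`, line `a`, family of local
splittings `𝓢`, characters `μ_v` (unitary, continuous, kernel = norms) and `χ₁` (unitary, continuous): the three MVW rank-one theta facts
[MoeglinVignerasWaldspurger1987, Chap. 3 IV.4 1a), 2a); IV.2], the unitarity `(𝓢.omegaLoc v).IsL2Isometric (μ'ⁿ)` of the local Weil representation,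
the split-place model consequences [Liu2021 l. 5253; GelbartRogawski1990 §2.6; Zelevinsky1980 Thm 4.2] and the isotropy of the hermitian space
imply `LemD1_1AsPrinted (localLemD1Data … v)`.  Statement = the body of `Summit.HodgeConjecture.CorCM.Lines.A4LiuD1pp.PerPlace.LemD1Item1AtV`
(a4-liuD1pp.lean 2ff805ec0320d57a), character for character; proof = fan B's composition
`Def411WeilCarriers.lemD1_1AsPrinted_localLemD1Data_of` (line `b4-lemD1-item1-at-v` v8, landed in `Liu2021/LemD1Item1AtVOfFacts.lean`).
[cite: Liu2021, App. D Lemma D.1 (1) (l. 5226–5229), proof l. 5249–5266] [cite: MoeglinVignerasWaldspurger1987, Chap. 3 IV.4 Thm principal 1a), 2a); IV.2]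
[cite: GelbartRogawski1990, §2.6] [cite: Zelevinsky1980, Thm. 4.2] -/
theorem lemD1Item1AtV :
    ∀ (F E : Type) [Field F] [NumberField F] [Field E] [NumberField E] [Algebra F E]
    (c : E ≃ₐ[F] E) (N : ℕ) {n : ℕ} (e : Fin N × Fin 1 ≃ Fin n)
    (JV : Matrix (Fin N) (Fin N) E) {TV : Matrix (Fin N) (Fin N) F}
    [Algebra.IsQuadraticExtension F E] {δ : E} (hcδ : c δ = -δ) (hδ : δ ≠ 0) {d : F}
    (hd : δ * δ = algebraMap F E d) (hV : TV.IsSymm) (hVd : IsUnit TV.det) (hJV : JV = TV.map (algebraMap F E))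
    (a : Fˣ)
    (𝓢 : LocalSplitting.FinLocalSplittings F E c n hcδ hδ hd (gram F e TV (TW F a)) (isSymm_gram F e hV (isSymm_TW F a))
      (reindex_kronecker_eq_gram_map F E e hJV (JW_eq F E a)))
    (hn : 3 ≤ n)
    (μ : ∀ v : HeightOneSpectrum (𝓞 F), (LocalRing E v)ˣ →* ℂˣ) (hμn : ∀ v x, ‖((μ v x : ℂˣ) : ℂ)‖ = 1)
    (hμc : ∀ v, Continuous fun x => ((μ v x : ℂˣ) : ℂ))
    (hμF : ∀ (v : HeightOneSpectrum (𝓞 F)) (t : (v.adicCompletion F)ˣ),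
      μ v (Units.map (algebraMap (v.adicCompletion F) (LocalRing E v)).toMonoidHom t) = 1 ↔
        ∃ x : (LocalRing E v)ˣ, (x : LocalRing E v) * conjLocal E c v x = algebraMap (v.adicCompletion F) (LocalRing E v) t)
    (χ₁ : UnitaryGroup.finAdelicOne F E c →* ℂˣ) (hχ₁n : ∀ u, ‖((χ₁ u : ℂˣ) : ℂ)‖ = 1) (hχ₁c : Continuous χ₁)
    (v : HeightOneSpectrum (𝓞 F)),
    mvw_IV4_rankOne_irreducibleOrZero → mvw_IV4_rankOne_admissible → mvw_IV2_rankOne_nonvanishing_of_isotropic →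
    ∀ [MeasurableSpace (v.adicCompletion F)] [BorelSpace (v.adicCompletion F)]
    (μ' : Measure (v.adicCompletion F)) [μ'.IsAddHaarMeasure],
    (𝓢.omegaLoc v).IsL2Isometric (Measure.pi fun _ : Fin n => μ') →
    (¬ IsField (LocalRing E v) → (𝓢.omegaLoc v).IsL2Isometric (Measure.pi fun _ : Fin n => μ') →
      IsIrreducibleOrZero (TwistedCoinv.rep
        (ρW := show Representation ℂ (localPi E c 1 (JW F E a) v) (SchwartzBruhat (Fin n → v.adicCompletion F)) from
          (𝓢.omegaLoc v).comp (localCenter E c n (Matrix.reindex e e (JV ⊗ₖ JW F E a)) (JW F E a) (JW_apply_ne_zero F E a) v))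
        (localCharOfCenter F E c (JW F E a) (JW_apply_ne_zero F E a) χ₁ v) (𝓢.omegaLoc v)
        (fun g z => (show Commute g (localCenter E c n (Matrix.reindex e e (JV ⊗ₖ JW F E a)) (JW F E a) (JW_apply_ne_zero F E a) v z) from
        localCenter_comm E c n (Matrix.reindex e e (JV ⊗ₖ JW F E a)) (JW F E a) (JW_apply_ne_zero F E a) v z g).map (𝓢.omegaLoc v))) ∧
      (TwistedCoinv.rep
        (ρW := show Representation ℂ (localPi E c 1 (JW F E a) v) (SchwartzBruhat (Fin n → v.adicCompletion F)) from
          (𝓢.omegaLoc v).comp (localCenter E c n (Matrix.reindex e e (JV ⊗ₖ JW F E a)) (JW F E a) (JW_apply_ne_zero F E a) v))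
        (localCharOfCenter F E c (JW F E a) (JW_apply_ne_zero F E a) χ₁ v) (𝓢.omegaLoc v)
        (fun g z => (show Commute g (localCenter E c n (Matrix.reindex e e (JV ⊗ₖ JW F E a)) (JW F E a) (JW_apply_ne_zero F E a) v z) from
        localCenter_comm E c n (Matrix.reindex e e (JV ⊗ₖ JW F E a)) (JW F E a) (JW_apply_ne_zero F E a) v z g).map (𝓢.omegaLoc v))).IsAdmissible ∧
      Nontrivial (TwistedCoinv.Coinv
        (show Representation ℂ (localPi E c 1 (JW F E a) v) (SchwartzBruhat (Fin n → v.adicCompletion F)) from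
          (𝓢.omegaLoc v).comp (localCenter E c n (Matrix.reindex e e (JV ⊗ₖ JW F E a)) (JW F E a) (JW_apply_ne_zero F E a) v))
        (localCharOfCenter F E c (JW F E a) (JW_apply_ne_zero F E a) χ₁ v))) →
    ¬ (localLemD1Data F E c N e JV hcδ hδ hd hV hVd hJV a 𝓢 hn μ hμn hμc hμF χ₁ hχ₁n hχ₁c v).IsAnisotropic →
    LemD1_1AsPrinted (localLemD1Data F E c N e JV hcδ hδ hd hV hVd hJV a 𝓢 hn μ hμn hμc hμF χ₁ hχ₁n hχ₁c v) :=
  fun F E _ _ _ _ _ c N _ e JV _ _ _ hcδ hδ _ hd hV hVd hJV a 𝓢 hn μ hμn hμc hμF χ₁ hχ₁n hχ₁c v hIV4a hIV4b hIV2 _ _ μ' _ hL2 hsplit hiso =>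
    lemD1_1AsPrinted_localLemD1Data_of F E c N e JV hcδ hδ hd hV hVd hJV a 𝓢 hn μ hμn hμc hμF χ₁ hχ₁n hχ₁c v hIV4a hIV4b hIV2 μ'
      hL2 hsplit hiso

end Summit.HodgeConjecture.CorCM.HypD1pp

end
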